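import Mathlib
import HarnessLib
import Summits.HubbardSuperconductivity.HubbardSuperconductivity.Theorems.KLProgrammeKLRegimeEngineValueClausesV17F

/-!
# K3 ENGINE-FLOW child (gen 7-flow, `KLRegimeEngineV17F`), stub (c) `stub_engine_step_values` (F shape): the ASSEMBLY of the four value conjuncts
# from their analytic parts — S6 «k3c2-p2 token re-key», part 1b (cell gate-hubbard-kl, seat hubbard-kl-k3c2-p2 g7)

The (c)-F conclusion (template HOME/planner-g16/…SkeletonV17F.template.lean 3e36d5aed02f155a l.541–558, (R30): (E4)ₙ moved to (b)) is
`PairLadderStepAtV17F … n ∧ PairValueIncrementAtV17F … n ∧ QuarticValueIncrementAtV17F … n ∧ IsoTupleL1AtV17F … n`.  As at V16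
(`klvr16_stepValues_of_reduced`), it follows from FOUR pieces: the ladder clause `hlad` (E2-F), the IN-CLASS half of (E2″-F) (`hin` — at V16 this
was discharged from `hlad` + (B1)(n−1) + a package line by the push-through `klvr11_…_inClass`; its F twin waits for the bare-truncated array
`klPairArrayF` of `…SplitSlotsV17F` rev 2, KL STATUS T2-2 11:02:58Z), the OUT-OF-CLASS half `hout`, and (E5-F) `hE5`; (E2′-F) is a corollary of
(E2″-F) (`klvrF_quarticValueIncrementAtV17F_of_pairValueIncrementAtV17F`).

* `klvrF_pairValueIncrementAtV17F_of_inClass_outClass` — (E2″-F) by cases on the pair class;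
* **`klvrF_stepValues_of_parts`** — the (c)-F conclusion from `hlad`, `hin`, `hout`, `hE5` (any `G P Q`; at registration `G = klEngGeo6`, `Q = klEngQ6 P R`).

Bookkeeping only; nothing about the model is asserted; nothing asserts superconductivity.
-/

noncomputable section

namespace Summit.HubbardSuperconductivity.HubbardSuperconductivity.Theorems.KLRegimeSplit

set_option linter.dupNamespace false -- summit = problem name (single-conjunct summit), D-0017

open Real Finset Literature.MathematicalPhysics.QuantumLattice Literature.Probability.LatticeModels
open Summit.HubbardSuperconductivity.HubbardSuperconductivity.Theorems.KLProgrammeLegKernels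

section Model

variable {L M : ℕ} [NeZero L] [NeZero M] {G : GeoConsts} {P : SplitConsts} {Q : EngConsts} {β U μ : ℝ} {n : ℕ}

/-- **(E2″-F) by cases on the pair class**: the in-class and the out-of-class halves of the cross-frame increment inequality give
`PairValueIncrementAtV17F … n`. -/
theorem klvrF_pairValueIncrementAtV17F_of_inClass_outClass
    (hin : ∀ Qm : TorusSite 2 L, IsPairClassAt L Qm n → ∀ k ∈ klBall L μ 0, ∀ k' ∈ klBall L μ 0,
      ‖klPairAmplitude L M β U μ (klFlowFrameU L M β U μ n) n Qm k k' -
          klPairAmplitude L M β U μ (klFlowFrameU L M β U μ (n - 1)) (n - 1) Qm k k'‖ ≤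
        gainBar G P U n (klTorusNorm L Qm) (klTorusNorm L (k - k')) (klTorusNorm L (k + k' - Qm)) +
          eremBar G P Q U β L (n - 1) + thermalBar G P U β n +
            legDressBarQ2 G P Q U n (legSliceCountT L β μ (klFlowFrameU L M β U μ n) n ![k', Qm - k', Qm - k, k]) +
              frameShiftBar P Q U n)
    (hout : ∀ Qm : TorusSite 2 L, ¬ IsPairClassAt L Qm n → ∀ k ∈ klBall L μ 0, ∀ k' ∈ klBall L μ 0,
      ‖klPairAmplitude L M β U μ (klFlowFrameU L M β U μ n) n Qm k k' -
          klPairAmplitude L M β U μ (klFlowFrameU L M β U μ (n - 1)) (n - 1) Qm k k'‖ ≤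
        gainBar G P U n (klTorusNorm L Qm) (klTorusNorm L (k - k')) (klTorusNorm L (k + k' - Qm)) +
          eremBar G P Q U β L (n - 1) + thermalBar G P U β n +
            legDressBarQ2 G P Q U n (legSliceCountT L β μ (klFlowFrameU L M β U μ n) n ![k', Qm - k', Qm - k, k]) +
              frameShiftBar P Q U n) :
    PairValueIncrementAtV17F L M G P Q β U μ n := by
  intro _hn Qm k hk k' hk'
  by_cases hQm : IsPairClassAt L Qm n
  · exact hin Qm hQm k hk k' hk'
  · exact hout Qm hQm k hk k' hk'

/-- **The (c)-F value conjuncts from their four parts**: the ladder clause (E2-F), the in-class and out-of-class halves of (E2″-F), and (E5-F)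
give `PairLadderStepAtV17F ∧ PairValueIncrementAtV17F ∧ QuarticValueIncrementAtV17F ∧ IsoTupleL1AtV17F` at `n` ((E2′-F) is derived). -/
theorem klvrF_stepValues_of_parts (hlad : PairLadderStepAtV17F L M G P Q β U μ n)
    (hin : ∀ Qm : TorusSite 2 L, IsPairClassAt L Qm n → ∀ k ∈ klBall L μ 0, ∀ k' ∈ klBall L μ 0,
      ‖klPairAmplitude L M β U μ (klFlowFrameU L M β U μ n) n Qm k k' -
          klPairAmplitude L M β U μ (klFlowFrameU L M β U μ (n - 1)) (n - 1) Qm k k'‖ ≤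
        gainBar G P U n (klTorusNorm L Qm) (klTorusNorm L (k - k')) (klTorusNorm L (k + k' - Qm)) +
          eremBar G P Q U β L (n - 1) + thermalBar G P U β n +
            legDressBarQ2 G P Q U n (legSliceCountT L β μ (klFlowFrameU L M β U μ n) n ![k', Qm - k', Qm - k, k]) +
              frameShiftBar P Q U n)
    (hout : ∀ Qm : TorusSite 2 L, ¬ IsPairClassAt L Qm n → ∀ k ∈ klBall L μ 0, ∀ k' ∈ klBall L μ 0,
      ‖klPairAmplitude L M β U μ (klFlowFrameU L M β U μ n) n Qm k k' -
          klPairAmplitude L M β U μ (klFlowFrameU L M β U μ (n - 1)) (n - 1) Qm k k'‖ ≤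
        gainBar G P U n (klTorusNorm L Qm) (klTorusNorm L (k - k')) (klTorusNorm L (k + k' - Qm)) +
          eremBar G P Q U β L (n - 1) + thermalBar G P U β n +
            legDressBarQ2 G P Q U n (legSliceCountT L β μ (klFlowFrameU L M β U μ n) n ![k', Qm - k', Qm - k, k]) +
              frameShiftBar P Q U n)
    (hE5 : IsoTupleL1AtV17F L M G P β U μ n) :
    PairLadderStepAtV17F L M G P Q β U μ n ∧ PairValueIncrementAtV17F L M G P Q β U μ n ∧
      QuarticValueIncrementAtV17F L M G P Q β U μ n ∧ IsoTupleL1AtV17F L M G P β U μ n := by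
  have h7 := klvrF_pairValueIncrementAtV17F_of_inClass_outClass hin hout
  exact ⟨hlad, h7, klvrF_quarticValueIncrementAtV17F_of_pairValueIncrementAtV17F h7, hE5⟩

/-- **In the thermal band the four parts collapse to two**: a sign-blind cross-frame increment bound `≤ thermalBar G P U β n` (all `Qm`, bare ball)
serves as BOTH `hin` and `hout`; with `hlad` and (E5-F) the (c)-F conclusion follows (`G/P/Q` well formed). -/
theorem klvrF_stepValues_of_ladder_signBlind (hG : G.WF) (hP : P.WF) (hQ : Q.WF) (hlad : PairLadderStepAtV17F L M G P Q β U μ n)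
    (h : ∀ Qm : TorusSite 2 L, ∀ k ∈ klBall L μ 0, ∀ k' ∈ klBall L μ 0,
      ‖klPairAmplitude L M β U μ (klFlowFrameU L M β U μ n) n Qm k k' -
          klPairAmplitude L M β U μ (klFlowFrameU L M β U μ (n - 1)) (n - 1) Qm k k'‖ ≤ thermalBar G P U β n)
    (hE5 : IsoTupleL1AtV17F L M G P β U μ n) :
    PairLadderStepAtV17F L M G P Q β U μ n ∧ PairValueIncrementAtV17F L M G P Q β U μ n ∧
      QuarticValueIncrementAtV17F L M G P Q β U μ n ∧ IsoTupleL1AtV17F L M G P β U μ n := by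
  have h2 := klbandF_values_of_le_thermalBar hG hP hQ h
  exact ⟨hlad, h2.1, h2.2, hE5⟩

end Model

end Summit.HubbardSuperconductivity.HubbardSuperconductivity.Theorems.KLRegimeSplit

end
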